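import Summits.AnomalousDissipation.AnomalousDissipation.Theorems.SawtoothPulseCascadeK2CombPreserved

/-!
# K2″ injection phase: REDUCTION of the registered stub `stub_injectionPhase` to the one
# perpendicular-slot estimate (the V half-slot acting on a horizontal residual comb)
(route `AnomalousDissipation/SawtoothPulseCascade`, crux K2″ = stmt-AnomalousDissipation-19696
`K2LinearisedCascadeGrowth`, registered line `phase-cocycle` (skeleton 0c87d78a), stub A
`stub_injectionPhase`; helper, `--supports`)

The registered stub A asks, for every box point `(γ, ρN) ∈ [4,8] × {2,…,7}`, for a threshold `ν₀ > 0` such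
that every classical solution `(w, q)` of the Navier–Stokes equations linearised at the cascade carrier on
the injection window `[tInject j₀ hz, tStart (j₀+1)]`, started from a residual-comb injection `w₀`
(`ShearCombDatum (P.N j₀) hz w₀`), obeys `‖w(t)‖²_{L²} ≤ (3e^{σ⋆γ})² ‖w₀‖²_{L²}` on the whole window.
Landed so far: `hz = false` with factor `1` for every `ν > 0` (`K2Classical.k2_injectionPhase_V`); the
H half-slot of `hz = true` with factor `1` and the comb class PRESERVED (`K2Classical.k2_injection_H_comb`);
the whole stub on the sub-box `γ ≤ 5.77` (`K2Classical.injectionPhase_of_le_577`, energy factor `e^{γ}` of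
the V half).

This file proves, kernel-checked, that what is left is EXACTLY ONE estimate about ONE half pulse: the
**perpendicular-slot bound** — every classical linearised response on the V half-slot
`[tStart j₀ + tHalf j₀, tStart (j₀+1)]` of phase `j₀` started from a HORIZONTAL residual comb `w₁`
(`ShearCombDatum (P.N j₀) true w₁`: streamwise wavenumbers = odd multiples of `N_{j₀}`, the modally
neutral integer relative wavenumbers of the sawtooth) is amplified in `L²`-energy by at most `C`.
No new definition is introduced: the estimate is written out as a hypothesis.

* `k2_injectionPhase_H_of_perpSlot` — pointwise in `P`, `ν`, `j₀`, any constant `1 ≤ C`: the perpendicular-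
  slot bound with constant `C` implies `‖w(t)‖² ≤ C ‖w₀‖²` on the whole H injection window (H half:
  `k2_injection_H_comb`, factor `1` and the state handed over at `tStart j₀ + tHalf j₀` is again a horizontal
  residual comb of frequency `N_{j₀}`; V half: restriction of the window solution to the slot + the hypothesis).
* `perpSlot_of_le_577` — the perpendicular-slot bound with the stub's constant `(3e^{σ⋆γ})²` HOLDS for
  `0 ≤ γ ≤ 5.77`, every `ν > 0` (crude energy factor `e^{γ}`, `K2Classical.vectorL2Sq_le_exp_of_mem_V` +
  `K2Classical.exp_le_cap_sq`), so nothing is lost by the reduction on the landed sub-box.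
* `injectionPhase_of_perpSlot` — **stub A verbatim** from the perpendicular-slot bound on the whole box.
* `injectionPhase_of_perpSlot_Ioc` — **stub A verbatim** from the perpendicular-slot bound on the residual
  range `γ ∈ (5.77, 8]` only (the sub-box `γ ≤ 5.77` is `injectionPhase_of_le_577`).

So the open content of `stub_injectionPhase` is, as a Lean signature, the hypothesis `hX` of
`injectionPhase_of_perpSlot_Ioc`: a non-modal (Orr + corner-wave) `L²` bound `≤ (3e^{σ⋆γ})²` — i.e. beating
the crude `e^{γ}` by at most `e^{(1−2σ⋆)8}/9 ≤ 21/9` — for the rounded, viscous, finite-time V pulse acting on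
a perpendicular comb at neutral wavenumbers, uniformly in `j₀` and `ν ≤ ν₀`.  Nothing here claims that bound.
-/

-- `Summit.<Summit>.<Problem>` is the tree's mandated summit-side namespace (CONVENTIONS §2); for this
-- single-conjunct summit the two coincide, so the duplicate is deliberate (lakefile: off for `Summits`).
set_option linter.dupNamespace false

noncomputable section

namespace Summit.AnomalousDissipation.AnomalousDissipation.Theorems.SawtoothPulseCascade.K2Classical

open Set MeasureTheory
open scoped ContDiff
open Literature.Analysis Literature.Analysis.FunctionSpaces Literature.Analysis.FluidPDE
open Literature.Analysis.FluidPDE.SawtoothCascade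
open Literature.Analysis.FluidPDE.SawtoothCascade.CascadeParams

/-! ## Bookkeeping -/

/-- The one-sided time derivative within a non-degenerate sub-interval `[a', b'] ⊆ [a, b]` of a field
jointly smooth on `[a, b]` agrees with the one within `[a, b]` (Mathlib `HasDerivWithinAt.mono`,
`HasDerivWithinAt.derivWithin`, `uniqueDiffOn_Icc`). -/
private theorem timeDerivWithin_Icc_eq_of_subset_P {a b a' b' : ℝ} (hlt : a' < b')
    (hsub : Icc a' b' ⊆ Icc a b) {w : ℝ → UnitAddTorus (Fin 2) → EuclideanSpace ℝ (Fin 2)}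
    (hw : Torus.IsSmoothSpaceTimeOn (Icc a b) w) {t : ℝ} (ht : t ∈ Icc a' b')
    (x : UnitAddTorus (Fin 2)) :
    Torus.timeDerivWithin (Icc a' b') w t x = Torus.timeDerivWithin (Icc a b) w t x :=
  ((hw.hasDerivWithinAt_slice (hsub ht) x).mono hsub).derivWithin (uniqueDiffOn_Icc hlt t ht)

/-- `0 ≤ ‖v‖²_{L²}`. -/
private theorem vectorL2Sq_nonneg_P (v : UnitAddTorus (Fin 2) → EuclideanSpace ℝ (Fin 2)) :
    0 ≤ Torus.vectorL2Sq v := by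
  unfold Torus.vectorL2Sq
  exact integral_nonneg fun _ => by positivity

/-- The V half-slot of phase `j₀` is a non-degenerate interval: `tStart j₀ + tHalf j₀ < tStart (j₀+1)`. -/
theorem tMid_lt_tStart_succ (j₀ : ℕ) : tStart j₀ + tHalf j₀ < tStart (j₀ + 1) := by
  rw [tStart_succ]; linarith [tHalf_pos j₀]

/-! ## The reduction, pointwise in the parameters -/

/-- **H injection phase from the perpendicular-slot bound (pointwise).**  Let `δ₀ > 0`, `d > 0`, `ν > 0`,
`1 ≤ C`, and assume the PERPENDICULAR-SLOT BOUND at `(P, ν, j₀, C)`: every classical linearised response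
`(w', q')` on the V half-slot `[tStart j₀ + tHalf j₀, tStart (j₀+1)]` started from a horizontal residual comb
`w₁` of frequency `N_{j₀}` satisfies `‖w'(t)‖² ≤ C ‖w₁‖²` on the slot.  Then every classical linearised
response `(w, q)` on the H injection window `[tInject j₀ true, tStart (j₀+1)]` to a horizontal residual-comb
injection `w₀` satisfies `‖w(t)‖² ≤ C ‖w₀‖²` on the whole window.  (H half: `k2_injection_H_comb` — factor `1`,
and `w (tStart j₀ + tHalf j₀)` is again a horizontal residual comb of frequency `N_{j₀}` with
`‖·‖² ≤ ‖w₀‖²`; V half: the restriction of `(w, q)` to the slot is a classical response from that comb.) -/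
theorem k2_injectionPhase_H_of_perpSlot (P : CascadeParams) (hδ₀ : 0 < P.δ₀) (hd : 0 < P.d)
    {ν : ℝ} (hν : 0 < ν) (j₀ : ℕ) {C : ℝ} (hC : 1 ≤ C)
    (hX : ∀ (w₁ : UnitAddTorus (Fin 2) → EuclideanSpace ℝ (Fin 2))
      (w' : ℝ → UnitAddTorus (Fin 2) → EuclideanSpace ℝ (Fin 2)) (q' : ℝ → UnitAddTorus (Fin 2) → ℝ),
      ShearCombDatum (P.N j₀) true w₁ →
      Torus.IsSmoothSpaceTimeOn (Icc (tStart j₀ + tHalf j₀) (tStart (j₀ + 1))) w' →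
      Torus.IsSmoothSpaceTimeOn (Icc (tStart j₀ + tHalf j₀) (tStart (j₀ + 1))) q' →
      (∀ t ∈ Icc (tStart j₀ + tHalf j₀) (tStart (j₀ + 1)), Torus.IsDivFree (w' t)) →
      (∀ t ∈ Icc (tStart j₀ + tHalf j₀) (tStart (j₀ + 1)), ∀ x,
        Torus.timeDerivWithin (Icc (tStart j₀ + tHalf j₀) (tStart (j₀ + 1))) w' t x +
          Torus.convect (P.field t) (w' t) x + Torus.convect (w' t) (P.field t) x =
            ν • Torus.laplacian (w' t) x - Torus.gradient (q' t) x) →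
      w' (tStart j₀ + tHalf j₀) = w₁ →
      ∀ t ∈ Icc (tStart j₀ + tHalf j₀) (tStart (j₀ + 1)),
        Torus.vectorL2Sq (w' t) ≤ C * Torus.vectorL2Sq w₁)
    (w₀ : UnitAddTorus (Fin 2) → EuclideanSpace ℝ (Fin 2))
    (w : ℝ → UnitAddTorus (Fin 2) → EuclideanSpace ℝ (Fin 2)) (q : ℝ → UnitAddTorus (Fin 2) → ℝ)
    (hdat : ShearCombDatum (P.N j₀) true w₀)
    (hw : Torus.IsSmoothSpaceTimeOn (Icc (CascadeParams.tInject j₀ true) (tStart (j₀ + 1))) w)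
    (hq : Torus.IsSmoothSpaceTimeOn (Icc (CascadeParams.tInject j₀ true) (tStart (j₀ + 1))) q)
    (hdiv : ∀ t ∈ Icc (CascadeParams.tInject j₀ true) (tStart (j₀ + 1)), Torus.IsDivFree (w t))
    (hlin : ∀ t ∈ Icc (CascadeParams.tInject j₀ true) (tStart (j₀ + 1)), ∀ x,
      Torus.timeDerivWithin (Icc (CascadeParams.tInject j₀ true) (tStart (j₀ + 1))) w t x +
        Torus.convect (P.field t) (w t) x + Torus.convect (w t) (P.field t) x =
          ν • Torus.laplacian (w t) x - Torus.gradient (q t) x)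
    (h0 : w (CascadeParams.tInject j₀ true) = w₀) :
    ∀ t ∈ Icc (CascadeParams.tInject j₀ true) (tStart (j₀ + 1)),
      Torus.vectorL2Sq (w t) ≤ C * Torus.vectorL2Sq w₀ := by
  intro t ht
  -- H half-slot: comb preserved, energy non-increasing
  have hslot : ∀ s ∈ Icc (tStart j₀) (tStart j₀ + tHalf j₀),
      ShearCombDatum (P.N j₀) true (w s) ∧ Torus.vectorL2Sq (w s) ≤ Torus.vectorL2Sq w₀ :=
    fun s hs => k2_injection_H_comb P hδ₀ hd hν j₀ w₀ w q hdat hw hq hdiv hlin h0 hs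
  have hE0 := vectorL2Sq_nonneg_P w₀
  have ht' : tStart j₀ ≤ t := by rw [← tInject_true j₀]; exact ht.1
  rcases le_total t (tStart j₀ + tHalf j₀) with h | h
  · calc Torus.vectorL2Sq (w t) ≤ Torus.vectorL2Sq w₀ := (hslot t ⟨ht', h⟩).2
      _ ≤ C * Torus.vectorL2Sq w₀ := le_mul_of_one_le_left hE0 hC
  · -- the state handed to the V half-slot
    have hmidmem : tStart j₀ + tHalf j₀ ∈ Icc (tStart j₀) (tStart j₀ + tHalf j₀) :=
      ⟨by linarith [tHalf_pos j₀], le_rfl⟩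
    obtain ⟨hcomb, hmid⟩ := hslot _ hmidmem
    -- restriction of the window solution to the V half-slot
    have hsub := Icc_V_subset_window j₀
    have hlt := tMid_lt_tStart_succ j₀
    have hlin' : ∀ s ∈ Icc (tStart j₀ + tHalf j₀) (tStart (j₀ + 1)), ∀ x,
        Torus.timeDerivWithin (Icc (tStart j₀ + tHalf j₀) (tStart (j₀ + 1))) w s x +
          Torus.convect (P.field s) (w s) x + Torus.convect (w s) (P.field s) x =
            ν • Torus.laplacian (w s) x - Torus.gradient (q s) x := by
      intro s hs x
      rw [timeDerivWithin_Icc_eq_of_subset_P hlt hsub hw hs x]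
      exact hlin s (hsub hs) x
    have hV := hX (w (tStart j₀ + tHalf j₀)) w q hcomb (hw.mono hsub) (hq.mono hsub)
      (fun s hs => hdiv s (hsub hs)) hlin' rfl t ⟨h, ht.2⟩
    calc Torus.vectorL2Sq (w t) ≤ C * Torus.vectorL2Sq (w (tStart j₀ + tHalf j₀)) := hV
      _ ≤ C * Torus.vectorL2Sq w₀ := mul_le_mul_of_nonneg_left hmid (zero_le_one.trans hC)

/-! ## The perpendicular-slot bound on the landed sub-box `γ ≤ 5.77` -/

/-- **The perpendicular-slot bound holds with the stub's constant for `0 ≤ γ ≤ 5.77`, every `ν > 0`**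
(crude energy factor `e^{γ}` of one half pulse, `vectorL2Sq_le_exp_of_mem_V`, and `e^{γ} ≤ (3e^{σ⋆γ})²`,
`exp_le_cap_sq`).  In fact for ANY datum `w₁`, comb or not. -/
theorem perpSlot_of_le_577 (P : CascadeParams) (hγ : 0 ≤ P.γ) (hγ' : P.γ ≤ 5.77)
    (hδ₀ : 0 < P.δ₀) (hd : 0 < P.d) {ν : ℝ} (hν : 0 < ν) (j₀ : ℕ)
    (w₁ : UnitAddTorus (Fin 2) → EuclideanSpace ℝ (Fin 2))
    (w' : ℝ → UnitAddTorus (Fin 2) → EuclideanSpace ℝ (Fin 2)) (q' : ℝ → UnitAddTorus (Fin 2) → ℝ)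
    (hw : Torus.IsSmoothSpaceTimeOn (Icc (tStart j₀ + tHalf j₀) (tStart (j₀ + 1))) w')
    (hq : Torus.IsSmoothSpaceTimeOn (Icc (tStart j₀ + tHalf j₀) (tStart (j₀ + 1))) q')
    (hdiv : ∀ t ∈ Icc (tStart j₀ + tHalf j₀) (tStart (j₀ + 1)), Torus.IsDivFree (w' t))
    (hlin : ∀ t ∈ Icc (tStart j₀ + tHalf j₀) (tStart (j₀ + 1)), ∀ x,
      Torus.timeDerivWithin (Icc (tStart j₀ + tHalf j₀) (tStart (j₀ + 1))) w' t x +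
        Torus.convect (P.field t) (w' t) x + Torus.convect (w' t) (P.field t) x =
          ν • Torus.laplacian (w' t) x - Torus.gradient (q' t) x)
    (h0 : w' (tStart j₀ + tHalf j₀) = w₁) :
    ∀ t ∈ Icc (tStart j₀ + tHalf j₀) (tStart (j₀ + 1)),
      Torus.vectorL2Sq (w' t) ≤ (3 * Real.exp (sawSigmaStar * P.γ)) ^ 2 * Torus.vectorL2Sq w₁ := by
  intro t ht
  have h1 := vectorL2Sq_le_exp_of_mem_V P hγ hδ₀ hd hν.le hw hq hdiv hlin (subset_refl _) ht
  rw [h0] at h1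
  exact h1.trans (mul_le_mul_of_nonneg_right (exp_le_cap_sq hγ') (vectorL2Sq_nonneg_P w₁))

/-! ## Stub A verbatim from the perpendicular-slot bound -/

/-- **`stub_injectionPhase` ⇐ the perpendicular-slot bound on the box.**  If for every box point
`(γ, ρN) ∈ [4,8] × {2,…,7}` there is `ν₀ > 0` such that for `ν ∈ (0, ν₀]` and every phase `j₀` the V
half-slot of phase `j₀` amplifies every classical linearised response started from a horizontal residual comb
of frequency `N_{j₀}` by at most `(3e^{σ⋆γ})²` in `L²`-energy, then the registered stub A holds VERBATIM
(`hz = false`: `k2_injectionPhase_V`, factor `1`, any `ν > 0`; `hz = true`: `k2_injectionPhase_H_of_perpSlot`). -/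
theorem injectionPhase_of_perpSlot
    (hX : ∀ γ ∈ Icc (4 : ℝ) 8, ∀ ρN ∈ Finset.Icc 2 7, ∃ ν₀ : ℝ, 0 < ν₀ ∧ ∀ ν ∈ Ioc 0 ν₀, ∀ (j₀ : ℕ)
      (w₁ : UnitAddTorus (Fin 2) → EuclideanSpace ℝ (Fin 2))
      (w' : ℝ → UnitAddTorus (Fin 2) → EuclideanSpace ℝ (Fin 2)) (q' : ℝ → UnitAddTorus (Fin 2) → ℝ),
      ShearCombDatum ((⟨γ, 1 / 4, 2, 1, ρN⟩ : CascadeParams).N j₀) true w₁ →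
      Torus.IsSmoothSpaceTimeOn (Icc (CascadeParams.tStart j₀ + CascadeParams.tHalf j₀)
        (CascadeParams.tStart (j₀ + 1))) w' →
      Torus.IsSmoothSpaceTimeOn (Icc (CascadeParams.tStart j₀ + CascadeParams.tHalf j₀)
        (CascadeParams.tStart (j₀ + 1))) q' →
      (∀ t ∈ Icc (CascadeParams.tStart j₀ + CascadeParams.tHalf j₀) (CascadeParams.tStart (j₀ + 1)),
        Torus.IsDivFree (w' t)) →
      (∀ t ∈ Icc (CascadeParams.tStart j₀ + CascadeParams.tHalf j₀) (CascadeParams.tStart (j₀ + 1)), ∀ x,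
        Torus.timeDerivWithin (Icc (CascadeParams.tStart j₀ + CascadeParams.tHalf j₀)
            (CascadeParams.tStart (j₀ + 1))) w' t x +
          Torus.convect ((⟨γ, 1 / 4, 2, 1, ρN⟩ : CascadeParams).field t) (w' t) x +
          Torus.convect (w' t) ((⟨γ, 1 / 4, 2, 1, ρN⟩ : CascadeParams).field t) x =
          ν • Torus.laplacian (w' t) x - Torus.gradient (q' t) x) →
      w' (CascadeParams.tStart j₀ + CascadeParams.tHalf j₀) = w₁ →
      ∀ t ∈ Icc (CascadeParams.tStart j₀ + CascadeParams.tHalf j₀) (CascadeParams.tStart (j₀ + 1)),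
        Torus.vectorL2Sq (w' t) ≤ (3 * Real.exp (sawSigmaStar * γ)) ^ 2 * Torus.vectorL2Sq w₁) :
    ∀ γ ∈ Icc (4 : ℝ) 8, ∀ ρN ∈ Finset.Icc 2 7, ∃ ν₀ : ℝ, 0 < ν₀ ∧ ∀ ν ∈ Ioc 0 ν₀, ∀ (j₀ : ℕ) (hz : Bool)
      (w₀ : UnitAddTorus (Fin 2) → EuclideanSpace ℝ (Fin 2))
      (w : ℝ → UnitAddTorus (Fin 2) → EuclideanSpace ℝ (Fin 2)) (q : ℝ → UnitAddTorus (Fin 2) → ℝ),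
      ShearCombDatum ((⟨γ, 1 / 4, 2, 1, ρN⟩ : CascadeParams).N j₀) hz w₀ →
      Torus.IsSmoothSpaceTimeOn (Icc (CascadeParams.tInject j₀ hz) (CascadeParams.tStart (j₀ + 1))) w →
      Torus.IsSmoothSpaceTimeOn (Icc (CascadeParams.tInject j₀ hz) (CascadeParams.tStart (j₀ + 1))) q →
      (∀ t ∈ Icc (CascadeParams.tInject j₀ hz) (CascadeParams.tStart (j₀ + 1)), Torus.IsDivFree (w t)) →
      (∀ t ∈ Icc (CascadeParams.tInject j₀ hz) (CascadeParams.tStart (j₀ + 1)), ∀ x,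
        Torus.timeDerivWithin (Icc (CascadeParams.tInject j₀ hz) (CascadeParams.tStart (j₀ + 1))) w t x +
          Torus.convect ((⟨γ, 1 / 4, 2, 1, ρN⟩ : CascadeParams).field t) (w t) x +
          Torus.convect (w t) ((⟨γ, 1 / 4, 2, 1, ρN⟩ : CascadeParams).field t) x =
          ν • Torus.laplacian (w t) x - Torus.gradient (q t) x) →
      w (CascadeParams.tInject j₀ hz) = w₀ →
      ∀ t ∈ Icc (CascadeParams.tInject j₀ hz) (CascadeParams.tStart (j₀ + 1)),
        Torus.vectorL2Sq (w t) ≤ (3 * Real.exp (sawSigmaStar * γ)) ^ 2 * Torus.vectorL2Sq w₀ := by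
  intro γ hγ ρN hρ
  obtain ⟨ν₀, hν₀, H⟩ := hX γ hγ ρN hρ
  refine ⟨ν₀, hν₀, fun ν hν j₀ hz w₀ w q hdat hw hq hdiv hlin h0 t ht => ?_⟩
  have hγ0 : (0 : ℝ) ≤ γ := by linarith [hγ.1]
  have hK : 1 ≤ (3 * Real.exp (sawSigmaStar * γ)) ^ 2 := by
    have h0' : (0 : ℝ) ≤ sawSigmaStar * γ := mul_nonneg (by norm_num [sawSigmaStar]) hγ0
    have : 1 ≤ 3 * Real.exp (sawSigmaStar * γ) := by linarith [Real.one_le_exp h0']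
    exact one_le_pow₀ this
  cases hz with
  | true =>
    exact k2_injectionPhase_H_of_perpSlot ⟨γ, 1 / 4, 2, 1, ρN⟩ (by norm_num) (by norm_num) hν.1 j₀ hK
      (H ν hν j₀) w₀ w q hdat hw hq hdiv hlin h0 t ht
  | false =>
    have hmax : max (CascadeParams.tInject j₀ false) (tStart j₀) = CascadeParams.tInject j₀ false :=
      max_eq_left (tInject_mem_Icc j₀ false).1
    have h1 := k2_injectionPhase_V ⟨γ, 1 / 4, 2, 1, ρN⟩ (by norm_num) (by norm_num) hν.1 j₀ w₀ w q
      hdat hw hq hdiv hlin h0 t (by rw [hmax]; exact ht)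
    exact h1.trans (le_mul_of_one_le_left (vectorL2Sq_nonneg_P w₀) hK)

/-- **`stub_injectionPhase` ⇐ the perpendicular-slot bound on the RESIDUAL range `γ ∈ (5.77, 8]`** — the
sub-box `γ ≤ 5.77` is the landed `injectionPhase_of_le_577` (threshold `1`), so the registered stub A holds
VERBATIM as soon as the perpendicular-slot bound is supplied for `γ ∈ (5.77, 8]`, `ρN ∈ {2,…,7}`.  The
hypothesis `hX` is the stub's exact open content as a Lean signature. -/
theorem injectionPhase_of_perpSlot_Ioc
    (hX : ∀ γ ∈ Ioc (5.77 : ℝ) 8, ∀ ρN ∈ Finset.Icc 2 7, ∃ ν₀ : ℝ, 0 < ν₀ ∧ ∀ ν ∈ Ioc 0 ν₀, ∀ (j₀ : ℕ)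
      (w₁ : UnitAddTorus (Fin 2) → EuclideanSpace ℝ (Fin 2))
      (w' : ℝ → UnitAddTorus (Fin 2) → EuclideanSpace ℝ (Fin 2)) (q' : ℝ → UnitAddTorus (Fin 2) → ℝ),
      ShearCombDatum ((⟨γ, 1 / 4, 2, 1, ρN⟩ : CascadeParams).N j₀) true w₁ →
      Torus.IsSmoothSpaceTimeOn (Icc (CascadeParams.tStart j₀ + CascadeParams.tHalf j₀)
        (CascadeParams.tStart (j₀ + 1))) w' →
      Torus.IsSmoothSpaceTimeOn (Icc (CascadeParams.tStart j₀ + CascadeParams.tHalf j₀)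
        (CascadeParams.tStart (j₀ + 1))) q' →
      (∀ t ∈ Icc (CascadeParams.tStart j₀ + CascadeParams.tHalf j₀) (CascadeParams.tStart (j₀ + 1)),
        Torus.IsDivFree (w' t)) →
      (∀ t ∈ Icc (CascadeParams.tStart j₀ + CascadeParams.tHalf j₀) (CascadeParams.tStart (j₀ + 1)), ∀ x,
        Torus.timeDerivWithin (Icc (CascadeParams.tStart j₀ + CascadeParams.tHalf j₀)
            (CascadeParams.tStart (j₀ + 1))) w' t x +
          Torus.convect ((⟨γ, 1 / 4, 2, 1, ρN⟩ : CascadeParams).field t) (w' t) x +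
          Torus.convect (w' t) ((⟨γ, 1 / 4, 2, 1, ρN⟩ : CascadeParams).field t) x =
          ν • Torus.laplacian (w' t) x - Torus.gradient (q' t) x) →
      w' (CascadeParams.tStart j₀ + CascadeParams.tHalf j₀) = w₁ →
      ∀ t ∈ Icc (CascadeParams.tStart j₀ + CascadeParams.tHalf j₀) (CascadeParams.tStart (j₀ + 1)),
        Torus.vectorL2Sq (w' t) ≤ (3 * Real.exp (sawSigmaStar * γ)) ^ 2 * Torus.vectorL2Sq w₁) :
    ∀ γ ∈ Icc (4 : ℝ) 8, ∀ ρN ∈ Finset.Icc 2 7, ∃ ν₀ : ℝ, 0 < ν₀ ∧ ∀ ν ∈ Ioc 0 ν₀, ∀ (j₀ : ℕ) (hz : Bool)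
      (w₀ : UnitAddTorus (Fin 2) → EuclideanSpace ℝ (Fin 2))
      (w : ℝ → UnitAddTorus (Fin 2) → EuclideanSpace ℝ (Fin 2)) (q : ℝ → UnitAddTorus (Fin 2) → ℝ),
      ShearCombDatum ((⟨γ, 1 / 4, 2, 1, ρN⟩ : CascadeParams).N j₀) hz w₀ →
      Torus.IsSmoothSpaceTimeOn (Icc (CascadeParams.tInject j₀ hz) (CascadeParams.tStart (j₀ + 1))) w →
      Torus.IsSmoothSpaceTimeOn (Icc (CascadeParams.tInject j₀ hz) (CascadeParams.tStart (j₀ + 1))) q →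
      (∀ t ∈ Icc (CascadeParams.tInject j₀ hz) (CascadeParams.tStart (j₀ + 1)), Torus.IsDivFree (w t)) →
      (∀ t ∈ Icc (CascadeParams.tInject j₀ hz) (CascadeParams.tStart (j₀ + 1)), ∀ x,
        Torus.timeDerivWithin (Icc (CascadeParams.tInject j₀ hz) (CascadeParams.tStart (j₀ + 1))) w t x +
          Torus.convect ((⟨γ, 1 / 4, 2, 1, ρN⟩ : CascadeParams).field t) (w t) x +
          Torus.convect (w t) ((⟨γ, 1 / 4, 2, 1, ρN⟩ : CascadeParams).field t) x =
          ν • Torus.laplacian (w t) x - Torus.gradient (q t) x) →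
      w (CascadeParams.tInject j₀ hz) = w₀ →
      ∀ t ∈ Icc (CascadeParams.tInject j₀ hz) (CascadeParams.tStart (j₀ + 1)),
        Torus.vectorL2Sq (w t) ≤ (3 * Real.exp (sawSigmaStar * γ)) ^ 2 * Torus.vectorL2Sq w₀ := by
  refine injectionPhase_of_perpSlot fun γ hγ ρN hρ => ?_
  rcases le_or_gt γ 5.77 with hle | hlt
  · -- landed sub-box: the crude energy factor suffices, every `ν > 0`
    refine ⟨1, one_pos, fun ν hν j₀ w₁ w' q' _ hw hq hdiv hlin h0 => ?_⟩
    exact perpSlot_of_le_577 ⟨γ, 1 / 4, 2, 1, ρN⟩ (by simp only; linarith [hγ.1]) hle (by norm_num)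
      (by norm_num) hν.1 j₀ w₁ w' q' hw hq hdiv hlin h0
  · exact hX γ ⟨hlt, hγ.2⟩ ρN hρ

end Summit.AnomalousDissipation.AnomalousDissipation.Theorems.SawtoothPulseCascade.K2Classical

end
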